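import Summits.NavierStokesRegularity.NavierStokesRegularity.Theorems.RellichScarScarRigidityPaintedLadderHarmonics
import Summits.NavierStokesRegularity.NavierStokesRegularity.Theorems.RellichScarScarRigidityVorticityDefectIBP
import HarnessLib

/-!
# `ScarRigidity`, line `moment-conditioned-rellich` — stub `stub_paintedLadderHigher` (PL≥2), part 8:
# moving all derivatives from the source onto the weight (iterated integration by parts on `ℝ³`)

Crux stmt-NavierStokesRegularity-11717 (route RellichScar), helper file (`--supports`) for the registered stub
`stub_paintedLadderHigher`.  The densities of the multipole expansion of `Dᵏ⁺¹(Q₁ − Q₂)` (parts 3, 5) are the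
components `Dᵏ⁺¹g(·)(e_J)` of derivatives of the source; their moments against the Taylor polynomials `P` of the
kernel are brought back to moments of `g` itself by `k + 1` integrations by parts
(`integral_mul_iteratedFDeriv_apply_eq`):

  `∫ P(y) Dᵇφ(y)(v) dy = (−1)ᵇ ∫ DᵇP(y)(v) φ(y) dy`

for smooth `P`, `φ` on `ℝ³` whose derivatives of complementary orders `i + j ∈ {b − 1, b}` have integrable products
`‖DⁱP‖ ‖Dʲφ‖ ≤ K/(‖y‖+a)⁴` (induction on `b`: `Dᵇ⁺¹φ(y)(v₀, v') = ∂_{v₀}[Dᵇφ(·)(v')]`, one integration by parts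
`∫ ∂_{v₀}(Pψ) = 0`, and `Dᵇ(∂_{v₀}P)(y)(v') = Dᵇ⁺¹P(y)(v₀, v')` by the commutation of `∂_{v₀}` with `Dᵇ` of part 3 — so
the directions are NOT reversed).  Also: graded bounds `‖DⁱP(y)‖ ≤ C‖y‖^{m−i}` for smooth positively homogeneous `P`
of degree `m` (`exists_norm_iteratedFDeriv_le_of_homogeneous`).
-/

noncomputable section

open Set Filter Function MeasureTheory Metric TopologicalSpace
open scoped Topology ContDiff
open Literature.Analysis.FluidPDE

set_option linter.dupNamespace false -- D-0017: `Summit.<S>.<S>.…` repeats the summit name by design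

-- nested operator types
set_option maxSynthPendingDepth 4

namespace Summit.NavierStokesRegularity.NavierStokesRegularity.Theorems.RellichScarScarRigidity

/-! ### Graded bounds for homogeneous functions -/

/-- **Graded bounds for the derivatives of a homogeneous function**: for `P` smooth and positively homogeneous of
degree `m = i + r`, `‖DⁱP(y)‖ ≤ C ‖y‖ʳ`. [folklore] -/
theorem exists_norm_iteratedFDeriv_le_of_homogeneous {P : EuclideanSpace ℝ (Fin 3) → ℝ} (hP : ContDiff ℝ ∞ P) {m : ℕ}
    (hhom : ∀ r : ℝ, 0 < r → ∀ y, P (r • y) = r ^ m * P y) {i r : ℕ} (h : m = i + r) :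
    ∃ C : ℝ, 0 ≤ C ∧ ∀ y, ‖iteratedFDeriv ℝ i P y‖ ≤ C * ‖y‖ ^ r :=
  exists_norm_le_of_homogeneous (hP.continuous_iteratedFDeriv (by exact_mod_cast le_top)) r fun ρ hρ y =>
    iteratedFDeriv_homogeneous hP (fun ρ hρ y => by rw [hhom ρ hρ y, smul_eq_mul]) h hρ y

/-! ### Iterated integration by parts -/

/-- `‖Dⁱ(∂ᵥP)(y)‖ ≤ ‖Dⁱ⁺¹P(y)‖ ‖v‖` for smooth `P` (`Dⁱ∂ᵥ = ∂ᵥDⁱ`). [folklore] -/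
theorem norm_iteratedFDeriv_fderiv_apply_le {P : EuclideanSpace ℝ (Fin 3) → ℝ} (hP : ContDiff ℝ ∞ P)
    (v : EuclideanSpace ℝ (Fin 3)) (i : ℕ) (y : EuclideanSpace ℝ (Fin 3)) :
    ‖iteratedFDeriv ℝ i (fun z => fderiv ℝ P z v) y‖ ≤ ‖iteratedFDeriv ℝ (i + 1) P y‖ * ‖v‖ := by
  rw [iteratedFDeriv_fderiv_apply_comm hP v i y, ← norm_fderiv_iteratedFDeriv]
  exact ContinuousLinearMap.le_opNorm _ _

/-- **Iterated integration by parts on `ℝ³`.**  For smooth `P`, `φ` with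
`‖DⁱP(y)‖ ‖Dʲφ(y)‖ ≤ K/(‖y‖+a)⁴` whenever `i + j ∈ {b − 1, b}` (`a > 0`), and fixed directions `v`:
`y ↦ P(y) Dᵇφ(y)(v)` and `y ↦ DᵇP(y)(v) φ(y)` are integrable and
`∫ P(y) Dᵇφ(y)(v) dy = (−1)ᵇ ∫ DᵇP(y)(v) φ(y) dy`. [folklore] -/
theorem integral_mul_iteratedFDeriv_apply_eq {a : ℝ} (ha : 0 < a) :
    ∀ (b : ℕ) (P φ : EuclideanSpace ℝ (Fin 3) → ℝ), ContDiff ℝ ∞ P → ContDiff ℝ ∞ φ → ∀ (K : ℝ),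
      (∀ i j : ℕ, b ≤ i + j + 1 → i + j ≤ b → ∀ y,
        ‖iteratedFDeriv ℝ i P y‖ * ‖iteratedFDeriv ℝ j φ y‖ ≤ K / (‖y‖ + a) ^ 4) →
      ∀ v : Fin b → EuclideanSpace ℝ (Fin 3),
        Integrable (fun y => P y * iteratedFDeriv ℝ b φ y v) volume ∧
        Integrable (fun y => iteratedFDeriv ℝ b P y v * φ y) volume ∧
        ∫ y, P y * iteratedFDeriv ℝ b φ y v = (-1 : ℝ) ^ b * ∫ y, iteratedFDeriv ℝ b P y v * φ y := by
  intro b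
  induction b with
  | zero =>
    intro P φ hP hφ K hK v
    have hb := hK 0 0 (by norm_num) le_rfl
    have hint : Integrable (fun y => P y * φ y) volume := by
      refine integrable_of_norm_le_apexWeight ((hP.continuous.mul hφ.continuous).aestronglyMeasurable) ha le_rfl
        (C := K) fun y => ?_
      have h := hb y
      rw [norm_iteratedFDeriv_zero, norm_iteratedFDeriv_zero] at h
      rwa [norm_mul]
    have e1 : (fun y => P y * iteratedFDeriv ℝ 0 φ y v) = fun y => P y * φ y := by
      funext y; rw [iteratedFDeriv_zero_apply]
    have e2 : (fun y => iteratedFDeriv ℝ 0 P y v * φ y) = fun y => P y * φ y := by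
      funext y; rw [iteratedFDeriv_zero_apply]
    rw [e1, e2]
    exact ⟨hint, hint, by rw [pow_zero, one_mul]⟩
  | succ b ih =>
    intro P φ hP hφ K hK v
    have hρ : ∀ y : EuclideanSpace ℝ (Fin 3), 0 < ‖y‖ + a := fun y => by positivity
    set v₀ : EuclideanSpace ℝ (Fin 3) := v 0 with hv₀
    set v' : Fin b → EuclideanSpace ℝ (Fin 3) := Fin.tail v with hv'
    -- the auxiliary functions
    set ψ : EuclideanSpace ℝ (Fin 3) → ℝ := fun y => iteratedFDeriv ℝ b φ y v' with hψ_def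
    set Pv : EuclideanSpace ℝ (Fin 3) → ℝ := fun y => fderiv ℝ P y v₀ with hPv_def
    have hDφ : ContDiff ℝ ∞ (iteratedFDeriv ℝ b φ) := hφ.iteratedFDeriv_right (m := ∞) le_rfl
    have hψ : ContDiff ℝ ∞ ψ :=
      (ContinuousMultilinearMap.apply ℝ (fun _ : Fin b => EuclideanSpace ℝ (Fin 3)) ℝ v').contDiff.comp hDφ
    have hPv : ContDiff ℝ ∞ Pv :=
      (ContinuousLinearMap.apply ℝ ℝ v₀).contDiff.comp (hP.fderiv_right (m := ∞) le_rfl)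
    -- `Dᵇ⁺¹φ(y)(v) = ∂_{v₀}ψ(y)` and `Dᵇ⁺¹P(y)(v) = DᵇPv(y)(v')`
    have eDφ : ∀ y, iteratedFDeriv ℝ (b + 1) φ y v = fderiv ℝ ψ y v₀ := by
      intro y
      rw [hψ_def, fderiv_continuousMultilinear_apply_const_apply ((hDφ.differentiable (by simp)) y),
        ← iteratedFDeriv_succ_apply_left]
    have eDP : ∀ y, iteratedFDeriv ℝ (b + 1) P y v = iteratedFDeriv ℝ b Pv y v' := by
      intro y
      rw [hPv_def, iteratedFDeriv_fderiv_apply_comm hP v₀ b y, ← iteratedFDeriv_succ_apply_left]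
    -- the induction hypothesis for `(Pv, φ)` with constant `K ‖v₀‖`
    have hK' : ∀ i j : ℕ, b ≤ i + j + 1 → i + j ≤ b → ∀ y,
        ‖iteratedFDeriv ℝ i Pv y‖ * ‖iteratedFDeriv ℝ j φ y‖ ≤ K * ‖v₀‖ / (‖y‖ + a) ^ 4 := by
      intro i j h1 h2 y
      have h := hK (i + 1) j (by omega) (by omega) y
      calc ‖iteratedFDeriv ℝ i Pv y‖ * ‖iteratedFDeriv ℝ j φ y‖
          ≤ (‖iteratedFDeriv ℝ (i + 1) P y‖ * ‖v₀‖) * ‖iteratedFDeriv ℝ j φ y‖ :=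
            mul_le_mul_of_nonneg_right (norm_iteratedFDeriv_fderiv_apply_le hP v₀ i y) (norm_nonneg _)
        _ = ‖iteratedFDeriv ℝ (i + 1) P y‖ * ‖iteratedFDeriv ℝ j φ y‖ * ‖v₀‖ := by ring
        _ ≤ K / (‖y‖ + a) ^ 4 * ‖v₀‖ := mul_le_mul_of_nonneg_right h (norm_nonneg _)
        _ = K * ‖v₀‖ / (‖y‖ + a) ^ 4 := by ring
    obtain ⟨I1, I2, EQ⟩ := ih Pv φ hPv hφ (K * ‖v₀‖) hK' v'
    -- integrability at level `b + 1`
    have hprod' : 0 ≤ ∏ i, ‖v' i‖ := by positivity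
    have hprod : 0 ≤ ∏ i, ‖v i‖ := by positivity
    have J1 : Integrable (fun y => P y * iteratedFDeriv ℝ (b + 1) φ y v) volume := by
      have hc : Continuous fun y => P y * iteratedFDeriv ℝ (b + 1) φ y v :=
        hP.continuous.mul ((ContinuousMultilinearMap.apply ℝ (fun _ : Fin (b + 1) => EuclideanSpace ℝ (Fin 3)) ℝ v).continuous.comp
          (hφ.continuous_iteratedFDeriv (by exact_mod_cast le_top)))
      refine integrable_of_norm_le_apexWeight hc.aestronglyMeasurable ha le_rfl (C := K * ∏ i, ‖v i‖) fun y => ?_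
      have h := hK 0 (b + 1) (by omega) (by omega) y
      rw [norm_iteratedFDeriv_zero] at h
      rw [norm_mul]
      calc ‖P y‖ * ‖iteratedFDeriv ℝ (b + 1) φ y v‖ ≤ ‖P y‖ * (‖iteratedFDeriv ℝ (b + 1) φ y‖ * ∏ i, ‖v i‖) :=
            mul_le_mul_of_nonneg_left (ContinuousMultilinearMap.le_opNorm _ _) (norm_nonneg _)
        _ = ‖P y‖ * ‖iteratedFDeriv ℝ (b + 1) φ y‖ * ∏ i, ‖v i‖ := by ring
        _ ≤ K / (‖y‖ + a) ^ 4 * ∏ i, ‖v i‖ := mul_le_mul_of_nonneg_right h hprod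
        _ = K * (∏ i, ‖v i‖) / (‖y‖ + a) ^ 4 := by ring
    have J2 : Integrable (fun y => iteratedFDeriv ℝ (b + 1) P y v * φ y) volume := by
      have hc : Continuous fun y => iteratedFDeriv ℝ (b + 1) P y v * φ y :=
        (((ContinuousMultilinearMap.apply ℝ (fun _ : Fin (b + 1) => EuclideanSpace ℝ (Fin 3)) ℝ v).continuous.comp
          (hP.continuous_iteratedFDeriv (by exact_mod_cast le_top)))).mul hφ.continuous
      refine integrable_of_norm_le_apexWeight hc.aestronglyMeasurable ha le_rfl (C := K * ∏ i, ‖v i‖) fun y => ?_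
      have h := hK (b + 1) 0 (by omega) (by omega) y
      rw [norm_iteratedFDeriv_zero] at h
      rw [norm_mul]
      calc ‖iteratedFDeriv ℝ (b + 1) P y v‖ * ‖φ y‖ ≤ (‖iteratedFDeriv ℝ (b + 1) P y‖ * ∏ i, ‖v i‖) * ‖φ y‖ :=
            mul_le_mul_of_nonneg_right (ContinuousMultilinearMap.le_opNorm _ _) (norm_nonneg _)
        _ = ‖iteratedFDeriv ℝ (b + 1) P y‖ * ‖φ y‖ * ∏ i, ‖v i‖ := by ring
        _ ≤ K / (‖y‖ + a) ^ 4 * ∏ i, ‖v i‖ := mul_le_mul_of_nonneg_right h hprod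
        _ = K * (∏ i, ‖v i‖) / (‖y‖ + a) ^ 4 := by ring
    have J3 : Integrable (fun y => P y * ψ y) volume := by
      refine integrable_of_norm_le_apexWeight ((hP.continuous.mul hψ.continuous).aestronglyMeasurable) ha le_rfl
        (C := K * ∏ i, ‖v' i‖) fun y => ?_
      have h := hK 0 b (by omega) (by omega) y
      rw [norm_iteratedFDeriv_zero] at h
      rw [norm_mul]
      calc ‖P y‖ * ‖ψ y‖ ≤ ‖P y‖ * (‖iteratedFDeriv ℝ b φ y‖ * ∏ i, ‖v' i‖) :=
            mul_le_mul_of_nonneg_left (ContinuousMultilinearMap.le_opNorm _ _) (norm_nonneg _)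
        _ = ‖P y‖ * ‖iteratedFDeriv ℝ b φ y‖ * ∏ i, ‖v' i‖ := by ring
        _ ≤ K / (‖y‖ + a) ^ 4 * ∏ i, ‖v' i‖ := mul_le_mul_of_nonneg_right h hprod'
        _ = K * (∏ i, ‖v' i‖) / (‖y‖ + a) ^ 4 := by ring
    -- one integration by parts: `∫ ∂_{v₀}(P ψ) = 0`
    have hPψ : ContDiff ℝ 1 fun y => P y * ψ y := (hP.mul hψ).of_le (by norm_cast)
    have hder : ∀ y, fderiv ℝ (fun y => P y * ψ y) y v₀ = Pv y * ψ y + P y * iteratedFDeriv ℝ (b + 1) φ y v := by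
      intro y
      rw [fderiv_fun_mul (hP.differentiable (by simp) y) (hψ.differentiable (by simp) y), eDφ y]
      simp only [add_apply, smul_apply, smul_eq_mul, hPv_def]
      ring
    have I1' : Integrable (fun y => Pv y * ψ y) volume := I1
    have h0 := integral_fderiv_apply_eq_zero_of_integrable hPψ v₀ J3 (by simp_rw [hder]; exact I1'.add J1)
    simp_rw [hder] at h0
    rw [integral_add I1' J1] at h0
    refine ⟨J1, J2, ?_⟩
    have e3 : ∫ y, iteratedFDeriv ℝ (b + 1) P y v * φ y = ∫ y, iteratedFDeriv ℝ b Pv y v' * φ y :=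
      integral_congr_ae (Eventually.of_forall fun y => by beta_reduce; rw [eDP y])
    rw [e3, pow_succ]
    have h4 : ∫ y, Pv y * ψ y = (-1 : ℝ) ^ b * ∫ y, iteratedFDeriv ℝ b Pv y v' * φ y := EQ
    linarith

/-! ### Registered sub-goal -/

/-- **Registered helper stub `stub_paintedLadderIteratedIBPTools`** of `stub_paintedLadderHigher` (crux
stmt-NavierStokesRegularity-11717, line `moment-conditioned-rellich`): iterated integration by parts on `ℝ³`,
`∫ P Dᵇφ(v) = (−1)ᵇ ∫ DᵇP(v) φ`, under integrable products of derivatives of complementary orders. [folklore] -/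
theorem stub_paintedLadderIteratedIBPTools :
    ∀ a : ℝ, 0 < a → ∀ (b : ℕ) (P φ : EuclideanSpace ℝ (Fin 3) → ℝ), ContDiff ℝ (⊤ : ℕ∞) P → ContDiff ℝ (⊤ : ℕ∞) φ → ∀ (K : ℝ), (∀ i j : ℕ, b ≤ i + j + 1 → i + j ≤ b → ∀ y, ‖iteratedFDeriv ℝ i P y‖ * ‖iteratedFDeriv ℝ j φ y‖ ≤ K / (‖y‖ + a) ^ 4) → ∀ v : Fin b → EuclideanSpace ℝ (Fin 3), Integrable (fun y => P y * iteratedFDeriv ℝ b φ y v) volume ∧ Integrable (fun y => iteratedFDeriv ℝ b P y v * φ y) volume ∧ ∫ y, P y * iteratedFDeriv ℝ b φ y v = (-1 : ℝ) ^ b * ∫ y, iteratedFDeriv ℝ b P y v * φ y :=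
  fun _a ha => integral_mul_iteratedFDeriv_apply_eq ha

end Summit.NavierStokesRegularity.NavierStokesRegularity.Theorems.RellichScarScarRigidity

end
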